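import Literature.NumberTheory.Automorphic.ShimuraCurveTakahashiCoordinateInputs
import Summits.ABC.ABC.Theses.DefiniteXi

/-! Plan T shape check (k1 g23, Literature + route file only, no stale Theorems modules):
(1) the 2026-08-28 named facts are, up to unfolding, the hypotheses `hTlev` / `hT2` of the landed
helpers p139336 / p162272 (copied verbatim below from `DefiniteXiSteinbergCoreXiDegreeComparison.lean`);
(2) the route item `IsogenyValuationTransport` is verbatim `PastenShimura2024_lemma_6_8`. -/

open Literature.NumberTheory.Automorphic Literature.NumberTheory.EllipticCurves
  Literature.NumberTheory.EllipticCurves.ModularForms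

example (h : takahashi2001_thm_2_3_shimura_level) :
    (∀ {N D M p m : ℕ}, p.Prime → M = p * m → ¬ p ∣ m →
      Literature.NumberTheory.Automorphic.IsAdmissibleFactorization N D M →
      ∀ (X : Literature.NumberTheory.Automorphic.ShimuraCurveData D M) (W : WeierstrassCurve ℚ)
        [W.IsElliptic], W.conductorNorm ℤ = N →
      ∀ (W' : WeierstrassCurve ℚ) [W'.IsElliptic]
        (P : Literature.NumberTheory.Automorphic.ShimuraParametrizationData X W'),
        P.IsMinimalFor W →
      ∀ S : Literature.NumberTheory.Automorphic.Brandt.XiSetup m (D * p),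
        ∃ i j : ℕ, 0 < i ∧ i * j = (W'.minimalDiscriminantNorm ℤ).factorization p ∧
          i ∣ S.xi (fun n => W'.LFunction n) ∧
          P.deg * i = S.xi (fun n => W'.LFunction n) * j) := h

example (h : takahashi2001_thm_2_3_shimura_disc) :
    (∀ {N D M p d : ℕ}, p.Prime → D = p * d →
      Literature.NumberTheory.Automorphic.IsAdmissibleFactorization N D M →
      ∀ (X : Literature.NumberTheory.Automorphic.ShimuraCurveData D M) (W : WeierstrassCurve ℚ)
        [W.IsElliptic], W.conductorNorm ℤ = N →
      ∀ (W' : WeierstrassCurve ℚ) [W'.IsElliptic]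
        (P : Literature.NumberTheory.Automorphic.ShimuraParametrizationData X W'),
        P.IsMinimalFor W →
      ∀ S : Literature.NumberTheory.Automorphic.Brandt.XiSetup (p * M) d,
        ∃ i j : ℕ, 0 < i ∧ i * j = (W'.minimalDiscriminantNorm ℤ).factorization p ∧
          i ∣ S.xi (fun n => W'.LFunction n) ∧
          P.deg * i = S.xi (fun n => W'.LFunction n) * j) := h

example : Summit.ABC.ABC.Theses.DefiniteXi.IsogenyValuationTransport ↔
    Literature.NumberTheory.EllipticCurves.ModularForms.PastenShimura2024_lemma_6_8 := Iff.rfl
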